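import Summits.SmoothPoincare4.SmoothPoincare4.Theses.EntropyRung
import Summits.SmoothPoincare4.SmoothPoincare4.Theorems.EntropyRungSubcylindricalExistenceGluingSmallScalesSchwarzschild
import Summits.SmoothPoincare4.SmoothPoincare4.Theorems.EntropyRungSubcylindricalExistenceGluingLargeScales
import Summits.SmoothPoincare4.SmoothPoincare4.Theorems.EntropyRungSubcylindricalExistenceGluingAllScales
import Summits.SmoothPoincare4.SmoothPoincare4.Theorems.EntropyRungSubcylindricalExistenceLogCutoff
import Literature.Geometry.Riemannian.PerelmanEntropyCutoff
import HarnessLib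

/-!
# All scales of the conformally-round-capped blow-up: the choice of constants
# (line `green-blowup-conformal-entropy`, reshape R-c3 "Schwarzschild gauge",
# crux `EntropyRung.SubcylindricalExistence`, stmt-SmoothPoincare4-10871; the analytic heart of
# Stub D' `stub_conformalGluingSchwarzschild`)

Lead c2's `GluingAllScales.allScales_clause` (p120881) re-threaded for Green data in the flat gauge
WITH MASS (`G(φ⁻¹y) = a/‖y − y₀‖² + b` on the flat chart ball, `b ≥ 0` constant). Given as
hypotheses (the four worker stubs of the reshape, specialised to the data): the cap factors `ψ_K`
(S3'), their PERTURBATIVE cap clauses (S2'M: level `log 6 − 2 − 100θ` for test functions supported in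
the chart ball of radius `ρ₁ ≤ r` whenever `bρ₁² ≤ θa`, `b ≤ θK`, `θ ≤ 1/100`), the volume bound
`∫ψ_K⁴ ≤ C₁ + C₂K²` (S5') and the cut-off bound `(C/log²S)²·32π² log S` (Cut'), plus the
Yamabe–Sobolev inequality of the class (S4, landed), the theorem `allScales_clause` chooses
`ε = min(δ, 0.026)/8`, `θ = ε/25`, the cut-off level `S = e^T` (`T ≥ 1`, `T ≥ 24πC₆C_Y⁺/(Yε)`,
`T ≥ G₀⁺ + 2a/r² + 2b + 1`, `T ≥ 50b/ε`), the cap radius `ρ₁ = √(2a/S)` (it captures `{G ≥ S}` and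
satisfies `bρ₁² ≤ θa`, `ρ₁ ≤ r`), the gradient bound `Λ(S³)`, and
`K ≥ max(1, 2S³/ε, 48Λ(√C₁⁺ + √C₂⁺)/(Yε²), 25b/ε)`, and proves: `ψ = ψ_K` is smooth, positive,
`L_g ψ > 0`, and the `ψ`-weighted `w²`-clause holds at level `ν_cyl + ε` at EVERY scale — small
scales `τ ≤ 3(√C₁⁺ + √C₂⁺K)/Y` by `GluingSmallScalesSchwarzschild.smallScales_clause` (cap level
`log 6 − 2 − 4ε = log 6 − 2 − 100θ`, cut-offs of H6 `logCutoff_exists`), large scales by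
`gluingLargeScales`. Everything is proved; no definitions, no named facts.
-/

noncomputable section

set_option linter.dupNamespace false

open scoped Manifold ContDiff Topology RealInnerProductSpace
open Set Filter MeasureTheory
open Literature.Geometry.Lorentzian

namespace Summit.SmoothPoincare4.SmoothPoincare4.Theorems

namespace GluingAllScalesSchwarzschild

variable {M : Type} [TopologicalSpace M] [T2Space M] [SecondCountableTopology M]
  [ChartedSpace (EuclideanSpace ℝ (Fin 4)) M] [IsManifold (𝓡 4) ∞ M] [CompactSpace M]
  [T3Space M] [MeasurableSpace M] [BorelSpace M]
  (g : PseudoRiemannianMetric (𝓡 4) ∞ (EuclideanSpace ℝ (Fin 4)) (TangentSpace (𝓡 4) : M → Type _))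

omit [T2Space M] [SecondCountableTopology M] [IsManifold (𝓡 4) ∞ M] [CompactSpace M] [T3Space M]
  [MeasurableSpace M] [BorelSpace M] in
/-- **The cap region is captured by a small chart ball.** In the flat gauge with mass
(`G(φ⁻¹y) = a/‖y − y₀‖² + b` on the closed chart ball of radius `r`), if `{G ≥ S}` lies in the open
chart ball of radius `r`, `b < S` and `a/(S − b) < ρ₁²` (`ρ₁ > 0`), then `{G ≥ S} ∖ {p}` lies in the
open chart ball of radius `ρ₁`. [folklore] -/
theorem capture_small {p : M} {G : M → ℝ} {a b r S ρ₁ : ℝ}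
    (hGform : ∀ y ∈ Metric.closedBall (extChartAt (𝓡 4) p p) r, y ≠ extChartAt (𝓡 4) p p →
      G ((extChartAt (𝓡 4) p).symm y) = a / ‖y - extChartAt (𝓡 4) p p‖ ^ 2 + b)
    (hbS : b < S) (hρ₁pos : 0 < ρ₁) (hρ₁ : a / (S - b) < ρ₁ ^ 2)
    (hcaptS : ∀ x, x ≠ p → S ≤ G x →
      x ∈ (extChartAt (𝓡 4) p).source ∧ extChartAt (𝓡 4) p x ∈ Metric.ball (extChartAt (𝓡 4) p p) r) :
    ∀ x, x ≠ p → S ≤ G x →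
      x ∈ {x | x ∈ (extChartAt (𝓡 4) p).source ∧
        extChartAt (𝓡 4) p x ∈ Metric.ball (extChartAt (𝓡 4) p p) ρ₁} := by
  intro x hx hGx
  obtain ⟨hxs, hxb⟩ := hcaptS x hx hGx
  refine ⟨hxs, ?_⟩
  have hyc : extChartAt (𝓡 4) p x ∈ Metric.closedBall (extChartAt (𝓡 4) p p) r :=
    Metric.ball_subset_closedBall hxb
  have hy0 : extChartAt (𝓡 4) p x ≠ extChartAt (𝓡 4) p p := fun h ↦
    hx ((extChartAt (𝓡 4) p).injOn hxs (mem_extChartAt_source p) h)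
  have hGy : G x = a / ‖extChartAt (𝓡 4) p x - extChartAt (𝓡 4) p p‖ ^ 2 + b := by
    rw [← hGform _ hyc hy0, (extChartAt (𝓡 4) p).left_inv hxs]
  have hn2 : 0 < ‖extChartAt (𝓡 4) p x - extChartAt (𝓡 4) p p‖ ^ 2 :=
    pow_pos (norm_pos_iff.2 (sub_ne_zero.2 hy0)) 2
  have hSb : 0 < S - b := by linarith
  -- `a/‖y−y₀‖² ≥ S − b`, so `‖y−y₀‖² ≤ a/(S−b) < ρ₁²`
  have h1 : S - b ≤ a / ‖extChartAt (𝓡 4) p x - extChartAt (𝓡 4) p p‖ ^ 2 := by linarith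
  have h2 : ‖extChartAt (𝓡 4) p x - extChartAt (𝓡 4) p p‖ ^ 2 ≤ a / (S - b) := by
    rw [le_div_iff₀ hSb]
    have := (le_div_iff₀ hn2).1 h1
    linarith
  rw [Metric.mem_ball, dist_eq_norm]
  exact lt_of_pow_lt_pow_left₀ 2 hρ₁pos.le (lt_of_le_of_lt h2 hρ₁)

set_option maxHeartbeats 800000 in
-- the statement carries eight long hypotheses and a long conclusion; elaboration of the final term
-- needs about 3× the default budget (all tactic steps are elementary)
/-- **The conformally-round-capped blow-up clears `ν_cyl` at all scales** (Schwarzschild gauge; see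
the module docstring). [cite: Perelman2002Entropy, §3.1] -/
theorem allScales_clause [g.HasLeviCivita] (hg : g.IsRiemannian) {p : M} {G : M → ℝ}
    (hGs : ContMDiffOn (𝓡 4) 𝓘(ℝ, ℝ) ∞ G {p}ᶜ) (hGpos : ∀ x, x ≠ p → 0 < G x)
    (hGlim : Tendsto G (𝓝[≠] p) atTop) {a b r : ℝ} (ha : 0 < a) (hb : 0 ≤ b) (hr : 0 < r)
    (hGform : ∀ y ∈ Metric.closedBall (extChartAt (𝓡 4) p p) r, y ≠ extChartAt (𝓡 4) p p →
      G ((extChartAt (𝓡 4) p).symm y) = a / ‖y - extChartAt (𝓡 4) p p‖ ^ 2 + b)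
    {δ : ℝ} (hδ : 0 < δ)
    (hBlow : ∀ τ : ℝ, 0 < τ → ∀ w : M → ℝ, ContMDiff (𝓡 4) 𝓘(ℝ, ℝ) ∞ w → w =ᶠ[𝓝 p] 0 →
      ∫ x, (4 * Real.pi * τ) ^ (-(4 : ℝ) / 2) * (w x) ^ 2 * (G x) ^ 4
          ∂(riemannianMeasure (g.toContMDiffRiemannianMetric hg)) = 1 →
        Real.log 2 + Real.log Real.pi / 2 - 3 / 2 + δ ≤
          ∫ x, (4 * τ * ((G x)⁻¹ ^ 2 * g.gradSq w x) - (w x) ^ 2 * Real.log ((w x) ^ 2)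
            - 4 * (w x) ^ 2) * ((4 * Real.pi * τ) ^ (-(4 : ℝ) / 2) * (G x) ^ 4)
          ∂(riemannianMeasure (g.toContMDiffRiemannianMetric hg)))
    {Y : ℝ} (hY : 0 < Y)
    (hYSall : ∀ (ψ : M → ℝ), ContMDiff (𝓡 4) 𝓘(ℝ, ℝ) ∞ ψ → (∀ x, 0 < ψ x) →
      ∀ (u : M → ℝ), ContMDiff (𝓡 4) 𝓘(ℝ, ℝ) ∞ u →
        Y * Real.sqrt (∫ x, u x ^ 4 * ψ x ^ 4 ∂(riemannianMeasure (g.toContMDiffRiemannianMetric hg))) ≤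
          ∫ x, (6 * (ψ x ^ 2 * g.gradSq u x)
              + ψ x * (g.scalarCurvature x * ψ x - 6 * g.dalembertian ψ x) * u x ^ 2)
            ∂(riemannianMeasure (g.toContMDiffRiemannianMetric hg)))
    (hfac : ∀ K : ℝ, 0 < K → ∃ ψ : M → ℝ, ContMDiff (𝓡 4) 𝓘(ℝ, ℝ) ∞ ψ ∧ (∀ x, 0 < ψ x) ∧
      (∀ x, 0 < g.scalarCurvature x * ψ x - 6 * g.dalembertian ψ x) ∧
      (∀ x, x ≠ p → ψ x = 4 * K * G x / (4 * K + G x)) ∧ ψ p = 4 * K)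
    (hcapall : ∀ K : ℝ, 0 < K → ∀ ψ : M → ℝ, ContMDiff (𝓡 4) 𝓘(ℝ, ℝ) ∞ ψ →
      (∀ x, x ≠ p → ψ x = 4 * K * G x / (4 * K + G x)) → ψ p = 4 * K →
      ∀ (ρ₁ θ : ℝ), 0 < ρ₁ → ρ₁ ≤ r → 0 < θ → θ ≤ 1 / 100 → b * ρ₁ ^ 2 ≤ θ * a → b ≤ θ * K →
      ∀ τ : ℝ, 0 < τ → ∀ v : M → ℝ, ContMDiff (𝓡 4) 𝓘(ℝ, ℝ) ∞ v →
        tsupport v ⊆ {x | x ∈ (extChartAt (𝓡 4) p).source ∧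
            extChartAt (𝓡 4) p x ∈ Metric.ball (extChartAt (𝓡 4) p p) ρ₁} →
        ∫ x, (4 * Real.pi * τ) ^ (-(4 : ℝ) / 2) * (v x) ^ 2 * (ψ x) ^ 4
            ∂(riemannianMeasure (g.toContMDiffRiemannianMetric hg)) = 1 →
          Real.log 6 - 2 - 100 * θ ≤
            ∫ x, (τ * ((ψ x ^ 3)⁻¹ * (g.scalarCurvature x * ψ x - 6 * g.dalembertian ψ x) * (v x) ^ 2
                  + 4 * ((ψ x)⁻¹ ^ 2 * g.gradSq v x))
                - (v x) ^ 2 * Real.log ((v x) ^ 2) - 4 * (v x) ^ 2)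
                * ((4 * Real.pi * τ) ^ (-(4 : ℝ) / 2) * (ψ x) ^ 4)
              ∂(riemannianMeasure (g.toContMDiffRiemannianMetric hg)))
    {C₁ C₂ : ℝ}
    (hvol : ∀ K : ℝ, 0 < K → ∀ ψ : M → ℝ, ContMDiff (𝓡 4) 𝓘(ℝ, ℝ) ∞ ψ →
      (∀ x, x ≠ p → ψ x = 4 * K * G x / (4 * K + G x)) → ψ p = 4 * K →
      ∫ x, (ψ x) ^ 4 ∂(riemannianMeasure (g.toContMDiffRiemannianMetric hg)) ≤ C₁ + C₂ * K ^ 2)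
    (hcut : ∀ (C S : ℝ), 0 ≤ C → 2 ≤ S → 2 * b ≤ S → a / r ^ 2 + b < S →
      ∀ (χ₁ χ₂ : M → ℝ), ContMDiff (𝓡 4) 𝓘(ℝ, ℝ) ∞ χ₁ → ContMDiff (𝓡 4) 𝓘(ℝ, ℝ) ∞ χ₂ →
      (∀ y, χ₁ y ^ 2 + χ₂ y ^ 2 = 1) → (∀ x, x ≠ p → G x ≤ S → χ₁ x = 1) →
      (∀ x, x ≠ p → S ^ 2 ≤ G x → χ₁ x = 0) → χ₁ p = 0 →
      (∀ x, x ≠ p → g.gradSq χ₁ x + g.gradSq χ₂ x ≤ C / Real.log S ^ 2 * ((G x)⁻¹ ^ 2 * g.gradSq G x)) →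
      Tendsto G (𝓝[≠] p) atTop →
      (∀ x, x ≠ p → S ≤ G x →
        x ∈ (extChartAt (𝓡 4) p).source ∧ extChartAt (𝓡 4) p x ∈ Metric.ball (extChartAt (𝓡 4) p p) r) →
      ∫ x, (g.gradSq χ₁ x + g.gradSq χ₂ x) ^ 2 ∂(riemannianMeasure (g.toContMDiffRiemannianMetric hg)) ≤
        (C / Real.log S ^ 2) ^ 2 * (32 * Real.pi ^ 2 * Real.log S)) :
    ∃ ψ : M → ℝ, ContMDiff (𝓡 4) 𝓘(ℝ, ℝ) ∞ ψ ∧ (∀ x, 0 < ψ x) ∧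
      (∀ x, 0 < g.scalarCurvature x * ψ x - 6 * g.dalembertian ψ x) ∧
      ∀ τ : ℝ, 0 < τ → ∀ w : M → ℝ, ContMDiff (𝓡 4) 𝓘(ℝ, ℝ) ∞ w →
        ∫ x, (4 * Real.pi * τ) ^ (-(4 : ℝ) / 2) * (w x) ^ 2 * (ψ x) ^ 4
            ∂(riemannianMeasure (g.toContMDiffRiemannianMetric hg)) = 1 →
          Real.log 2 + Real.log Real.pi / 2 - 3 / 2 + min δ 0.026 / 8 ≤
            ∫ x, (τ * ((ψ x ^ 3)⁻¹ * (g.scalarCurvature x * ψ x - 6 * g.dalembertian ψ x) * (w x) ^ 2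
                  + 4 * ((ψ x)⁻¹ ^ 2 * g.gradSq w x))
              - (w x) ^ 2 * Real.log ((w x) ^ 2) - 4 * (w x) ^ 2)
              * ((4 * Real.pi * τ) ^ (-(4 : ℝ) / 2) * (ψ x) ^ 4)
            ∂(riemannianMeasure (g.toContMDiffRiemannianMetric hg)) := by
  haveI : Nonempty M := ⟨p⟩
  -- ε and θ = ε/25
  generalize hε8 : min δ 0.026 / 8 = ε
  have hε : 0 < ε := by rw [← hε8]; positivity
  have hεδ : 8 * ε ≤ δ := by rw [← hε8]; linarith [min_le_left δ 0.026]
  have hε26 : 8 * ε ≤ 0.026 := by rw [← hε8]; linarith [min_le_right δ 0.026]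
  have hθ : 0 < ε / 25 := by positivity
  have hθ100 : ε / 25 ≤ 1 / 100 := by linarith
  -- the unit cap factor (gradient bound) and the cut-off constant
  obtain ⟨ψ₁, hψ₁, hψ₁pos, -, hψ₁G, -⟩ := hfac 1 one_pos
  obtain ⟨C₆, hC₆, hcut6⟩ := logCutoff_exists
  have hGc : ContinuousOn G {p}ᶜ := hGs.continuousOn
  obtain ⟨G₀, hG₀⟩ := GluingConstants.exists_capture (p := p) hGc hr
  -- the cost constant
  have hCst0 : 0 ≤ max (3 * (4 + 2 * Real.log (4 * Real.pi) - 2 * Real.log Y) + 6 * Real.log 6 - 6) 0 :=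
    le_max_right _ _
  -- `T` and `S = e^T`
  obtain ⟨T, hT1, hTA, hTG, hTB⟩ : ∃ T : ℝ, 1 ≤ T ∧
      24 * Real.pi * C₆ * max (3 * (4 + 2 * Real.log (4 * Real.pi) - 2 * Real.log Y) + 6 * Real.log 6 - 6) 0
        / (Y * ε) ≤ T ∧ max G₀ 0 + 2 * a / r ^ 2 + 2 * b + 1 ≤ T ∧ 50 * b / ε ≤ T :=
    ⟨max (max 1 (24 * Real.pi * C₆ *
        max (3 * (4 + 2 * Real.log (4 * Real.pi) - 2 * Real.log Y) + 6 * Real.log 6 - 6) 0 / (Y * ε)))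
        (max (max G₀ 0 + 2 * a / r ^ 2 + 2 * b + 1) (50 * b / ε)),
      (le_max_left _ _).trans (le_max_left _ _), (le_max_right _ _).trans (le_max_left _ _),
      (le_max_left _ _).trans (le_max_right _ _), (le_max_right _ _).trans (le_max_right _ _)⟩
  have hT0 : 0 < T := by linarith
  obtain ⟨S, hS1, hlogS, hST⟩ : ∃ S : ℝ, 1 < S ∧ Real.log S = T ∧ T + 1 ≤ S :=
    ⟨Real.exp T, Real.one_lt_exp_iff.2 hT0, Real.log_exp T, Real.add_one_le_exp T⟩
  have hS0 : 0 < S := by linarith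
  have har2 : 0 ≤ 2 * a / r ^ 2 := by positivity
  have hG00 : 0 ≤ max G₀ 0 := le_max_right _ _
  have hS2 : 2 ≤ S := by linarith
  have h2bS : 2 * b ≤ S := by linarith
  have hbS : b < S := by linarith
  have haS : a / r ^ 2 + b < S := by
    have : a / r ^ 2 ≤ 2 * a / r ^ 2 :=
      div_le_div_of_nonneg_right (by linarith) (by positivity)
    linarith
  have ha2S : 2 * a / r ^ 2 ≤ S := by linarith
  have hG₀S : G₀ ≤ S := by linarith [le_max_left G₀ 0]
  have hbεS : 50 * b / ε ≤ S := by linarith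
  -- the open chart ball and its capture property
  have hpU : p ∈ {x | x ∈ (extChartAt (𝓡 4) p).source ∧
      extChartAt (𝓡 4) p x ∈ Metric.ball (extChartAt (𝓡 4) p p) r} :=
    ⟨mem_extChartAt_source p, Metric.mem_ball_self hr⟩
  have hcaptS : ∀ x, x ≠ p → S ≤ G x →
      x ∈ (extChartAt (𝓡 4) p).source ∧ extChartAt (𝓡 4) p x ∈ Metric.ball (extChartAt (𝓡 4) p p) r :=
    fun x hx hGx ↦ hG₀ x hx (hG₀S.trans hGx)
  -- the cap radius `ρ₁ = √(2a/S)`: `ρ₁ ≤ r`, `bρ₁² ≤ θa`, and it captures `{G ≥ S}`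
  obtain ⟨ρ₁, hρ₁, hρ₁sq⟩ : ∃ ρ₁ : ℝ, 0 < ρ₁ ∧ ρ₁ ^ 2 = 2 * a / S :=
    ⟨Real.sqrt (2 * a / S), Real.sqrt_pos.2 (by positivity), Real.sq_sqrt (by positivity)⟩
  have hρ₁r : ρ₁ ≤ r := by
    have h1 : ρ₁ ^ 2 ≤ r ^ 2 := by
      rw [hρ₁sq, div_le_iff₀ hS0]
      have := (div_le_iff₀ (show (0 : ℝ) < r ^ 2 by positivity)).1 ha2S
      linarith
    exact le_of_pow_le_pow_left₀ two_ne_zero hr.le h1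
  have hbρ : b * ρ₁ ^ 2 ≤ ε / 25 * a := by
    rw [hρ₁sq, show b * (2 * a / S) = (2 * a * b) / S by ring, div_le_iff₀ hS0]
    have h1 : 50 * b ≤ S * ε := (div_le_iff₀ hε).1 hbεS
    nlinarith
  have hcapρ : a / (S - b) < ρ₁ ^ 2 := by
    rw [hρ₁sq, div_lt_div_iff₀ (by linarith) hS0]
    nlinarith [mul_pos ha (show (0 : ℝ) < S - 2 * b by linarith)]
  have hpU₁ : p ∈ {x | x ∈ (extChartAt (𝓡 4) p).source ∧
      extChartAt (𝓡 4) p x ∈ Metric.ball (extChartAt (𝓡 4) p p) ρ₁} :=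
    ⟨mem_extChartAt_source p, Metric.mem_ball_self hρ₁⟩
  have hcapt₁ := capture_small (p := p) hGform hbS hρ₁ hcapρ hcaptS
  -- `Λ`
  obtain ⟨Λ, hΛ0, hΛ⟩ := GluingConstants.exists_coreGradBound g hg hGpos hψ₁ hψ₁pos hψ₁G
    (S := S ^ 3) (by positivity)
  -- `K`
  have hC₁' : 0 ≤ max C₁ 0 := le_max_right _ _
  have hC₂' : 0 ≤ max C₂ 0 := le_max_right _ _
  obtain ⟨K, hK1, hKS, hKΛ, hKB⟩ : ∃ K : ℝ, 1 ≤ K ∧ 2 * S ^ 3 / ε ≤ K ∧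
      48 * Λ * (Real.sqrt (max C₁ 0) + Real.sqrt (max C₂ 0)) / (Y * ε ^ 2) ≤ K ∧ 25 * b / ε ≤ K :=
    ⟨max (max 1 (2 * S ^ 3 / ε))
        (max (48 * Λ * (Real.sqrt (max C₁ 0) + Real.sqrt (max C₂ 0)) / (Y * ε ^ 2)) (25 * b / ε)),
      (le_max_left _ _).trans (le_max_left _ _), (le_max_right _ _).trans (le_max_left _ _),
      (le_max_left _ _).trans (le_max_right _ _), (le_max_right _ _).trans (le_max_right _ _)⟩
  have hK0 : 0 < K := by linarith
  have hbK : b ≤ ε / 25 * K := by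
    have h1 : 25 * b ≤ K * ε := (div_le_iff₀ hε).1 hKB
    nlinarith
  -- `ψ = ψ_K`
  obtain ⟨ψ, hψ, hψpos, hLψ, hψG, hψp⟩ := hfac K hK0
  refine ⟨ψ, hψ, hψpos, hLψ, ?_⟩
  -- volume and the base scale
  have hVpos := GluingConstants.integral_pow_four_pos' g hg hψ.continuous hψpos
  have hVle : ∫ x, ψ x ^ 4 ∂(riemannianMeasure (g.toContMDiffRiemannianMetric hg)) ≤
      max C₁ 0 + max C₂ 0 * K ^ 2 := by
    refine (hvol K hK0 ψ hψ hψG hψp).trans ?_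
    have h2 := mul_le_mul_of_nonneg_right (le_max_left C₂ 0) (sq_nonneg K)
    linarith [le_max_left C₁ 0]
  have hsqV : Real.sqrt (∫ x, ψ x ^ 4 ∂(riemannianMeasure (g.toContMDiffRiemannianMetric hg))) ≤
      Real.sqrt (max C₁ 0) + Real.sqrt (max C₂ 0) * K :=
    (Real.sqrt_le_sqrt hVle).trans (GluingConstants.sqrt_quad_le hC₁' hC₂' hK0.le)
  have hτ₀le : 3 * Real.sqrt (∫ x, ψ x ^ 4 ∂(riemannianMeasure (g.toContMDiffRiemannianMetric hg))) / Y ≤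
      3 * (Real.sqrt (max C₁ 0) + Real.sqrt (max C₂ 0) * K) / Y :=
    div_le_div_of_nonneg_right (by linarith) hY.le
  have hτ₀pos : 0 < 3 * Real.sqrt (∫ x, ψ x ^ 4 ∂(riemannianMeasure (g.toContMDiffRiemannianMetric hg))) / Y := by
    have := Real.sqrt_pos.2 hVpos
    positivity
  -- the cap clause at level `log 6 − 2 − 4ε` on the small chart ball
  have hcapU : ∀ τ : ℝ, 0 < τ → ∀ v : M → ℝ, ContMDiff (𝓡 4) 𝓘(ℝ, ℝ) ∞ v →
      tsupport v ⊆ {x | x ∈ (extChartAt (𝓡 4) p).source ∧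
          extChartAt (𝓡 4) p x ∈ Metric.ball (extChartAt (𝓡 4) p p) ρ₁} →
      ∫ x, (4 * Real.pi * τ) ^ (-(4 : ℝ) / 2) * (v x) ^ 2 * (ψ x) ^ 4
          ∂(riemannianMeasure (g.toContMDiffRiemannianMetric hg)) = 1 →
        Real.log 6 - 2 - 4 * ε ≤
          ∫ x, (τ * ((ψ x ^ 3)⁻¹ * (g.scalarCurvature x * ψ x - 6 * g.dalembertian ψ x) * (v x) ^ 2
                + 4 * ((ψ x)⁻¹ ^ 2 * g.gradSq v x))
            - (v x) ^ 2 * Real.log ((v x) ^ 2) - 4 * (v x) ^ 2)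
            * ((4 * Real.pi * τ) ^ (-(4 : ℝ) / 2) * (ψ x) ^ 4)
          ∂(riemannianMeasure (g.toContMDiffRiemannianMetric hg)) := by
    intro τ hτ v hv hvs hn
    have h := hcapall K hK0 ψ hψ hψG hψp ρ₁ (ε / 25) hρ₁ hρ₁r hθ hθ100 hbρ hbK τ hτ v hv hvs hn
    linarith
  -- the cut-offs at the level `S` and the cost bound
  obtain ⟨χ₁, χ₂, hχ₁, hχ₂, h1, hone, hzero, hχ₁p, hbound, -, -⟩ := hcut6 M g hg p G hGs hGpos hGlim S hS1
  have hQ := hcut C₆ S hC₆.le hS2 h2bS haS χ₁ χ₂ hχ₁ hχ₂ h1 hone hzero hχ₁p hbound hGlim hcaptS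
  rw [hlogS] at hQ
  have hΘ : Real.sqrt (∫ x, (g.gradSq χ₁ x + g.gradSq χ₂ x) ^ 2
      ∂(riemannianMeasure (g.toContMDiffRiemannianMetric hg))) ≤ C₆ / T ^ 2 * (6 * Real.pi * Real.sqrt T) := by
    rw [Real.sqrt_le_iff]
    refine ⟨by positivity, hQ.trans ?_⟩
    rw [mul_pow, mul_pow, mul_pow, Real.sq_sqrt hT0.le]
    have hpi : 0 ≤ Real.pi ^ 2 := sq_nonneg _
    have hc : 0 ≤ (C₆ / T ^ 2) ^ 2 := sq_nonneg _
    nlinarith [mul_nonneg (mul_nonneg hc hpi) hT0.le]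
  have hcost : 4 / Y * max (3 * (4 + 2 * Real.log (4 * Real.pi) - 2 * Real.log Y) + 6 * Real.log 6 - 6) 0 *
      (C₆ / T ^ 2 * (6 * Real.pi * Real.sqrt T)) ≤ ε := by
    have hsqT : Real.sqrt T ≤ T := Real.sqrt_le_iff.2 ⟨hT0.le, by nlinarith⟩
    have h1' : C₆ / T ^ 2 * (6 * Real.pi * Real.sqrt T) ≤ 6 * Real.pi * C₆ / T := by
      calc C₆ / T ^ 2 * (6 * Real.pi * Real.sqrt T) ≤ C₆ / T ^ 2 * (6 * Real.pi * T) := by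
            gcongr
        _ = 6 * Real.pi * C₆ / T := by field_simp
    have h2' : 4 / Y * max (3 * (4 + 2 * Real.log (4 * Real.pi) - 2 * Real.log Y) + 6 * Real.log 6 - 6) 0 *
        (6 * Real.pi * C₆ / T) ≤ ε := by
      rw [show 4 / Y * max (3 * (4 + 2 * Real.log (4 * Real.pi) - 2 * Real.log Y) + 6 * Real.log 6 - 6) 0 *
          (6 * Real.pi * C₆ / T) = (24 * Real.pi * C₆ *
          max (3 * (4 + 2 * Real.log (4 * Real.pi) - 2 * Real.log Y) + 6 * Real.log 6 - 6) 0 / (Y * ε)) * ε / T by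
          field_simp; ring]
      rw [div_le_iff₀ hT0]
      have := mul_le_mul_of_nonneg_right hTA hε.le
      nlinarith
    exact (mul_le_mul_of_nonneg_left h1' (by positivity)).trans h2'
  -- the largeness condition at the top small scale
  have hKT : 16 * (3 * (Real.sqrt (max C₁ 0) + Real.sqrt (max C₂ 0) * K) / Y) * Λ ≤ ε ^ 2 * K ^ 2 := by
    have hYε : 0 < Y * ε ^ 2 := mul_pos hY (pow_pos hε 2)
    have hKΛ' : 48 * Λ * (Real.sqrt (max C₁ 0) + Real.sqrt (max C₂ 0)) ≤ K * (Y * ε ^ 2) :=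
      (div_le_iff₀ hYε).1 hKΛ
    have hmono : Real.sqrt (max C₁ 0) + Real.sqrt (max C₂ 0) * K ≤
        (Real.sqrt (max C₁ 0) + Real.sqrt (max C₂ 0)) * K := by
      have h := mul_le_mul_of_nonneg_left hK1 (Real.sqrt_nonneg (max C₁ 0))
      rw [mul_one] at h
      linarith [h]
    rw [show 16 * (3 * (Real.sqrt (max C₁ 0) + Real.sqrt (max C₂ 0) * K) / Y) * Λ =
        48 * Λ * (Real.sqrt (max C₁ 0) + Real.sqrt (max C₂ 0) * K) / Y by ring,
      div_le_iff₀ hY]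
    calc 48 * Λ * (Real.sqrt (max C₁ 0) + Real.sqrt (max C₂ 0) * K)
        ≤ 48 * Λ * ((Real.sqrt (max C₁ 0) + Real.sqrt (max C₂ 0)) * K) :=
          mul_le_mul_of_nonneg_left hmono (by positivity)
      _ = 48 * Λ * (Real.sqrt (max C₁ 0) + Real.sqrt (max C₂ 0)) * K := by ring
      _ ≤ K * (Y * ε ^ 2) * K := mul_le_mul_of_nonneg_right hKΛ' hK0.le
      _ = ε ^ 2 * K ^ 2 * Y := by ring
  -- small scales
  have hsmall := GluingSmallScalesSchwarzschild.smallScales_clause g hg hGs hGpos hGlim hBlow hK0 hψ hψpos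
    hψG hLψ hY (hYSall ψ hψ hψpos) hpU₁ hcapU hS1 hΛ0 hΛ hχ₁ hχ₂ h1 hone hzero hχ₁p
    (fun x hx hGx ↦ hcapt₁ x hx hGx) hε hεδ hε26 hΘ hcost hKS hKT
  -- large scales, from the clause at the base scale
  have hlarge := gluingLargeScales M g hg Y hY ψ hψ hψpos hLψ (hYSall ψ hψ hψpos) hVpos
    (Real.log 2 + Real.log Real.pi / 2 - 3 / 2 + ε) (fun w hw hn ↦ hsmall _ hτ₀pos hτ₀le w hw hn)
  -- all scales
  intro τ hτ w hw hnorm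
  by_cases hcase : τ ≤ 3 * Real.sqrt (∫ x, ψ x ^ 4 ∂(riemannianMeasure (g.toContMDiffRiemannianMetric hg))) / Y
  · exact hsmall τ hτ (hcase.trans hτ₀le) w hw hnorm
  · exact hlarge τ (le_of_not_ge hcase) w hw hnorm

end GluingAllScalesSchwarzschild

/-- Registered helper `helper_captureSmallSchwarzschild` of crux stmt-SmoothPoincare4-10871 (∀-form of
`GluingAllScalesSchwarzschild.capture_small`: in the flat gauge with mass the cap region `{G ≥ S}` sits
in the chart ball of radius `ρ₁` once `a/(S − b) < ρ₁²`; this module also carries `allScales_clause`,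
whose ∀-form exceeds the stub-signature limit). [folklore] -/
theorem helper_captureSmallSchwarzschild :
    ∀ (M : Type) [TopologicalSpace M] [T2Space M] [SecondCountableTopology M]
      [ChartedSpace (EuclideanSpace ℝ (Fin 4)) M] [IsManifold (𝓡 4) ∞ M] [CompactSpace M]
      [T3Space M] [MeasurableSpace M] [BorelSpace M] (p : M) (G : M → ℝ) (a b r S ρ₁ : ℝ),
      (∀ y ∈ Metric.closedBall (extChartAt (𝓡 4) p p) r, y ≠ extChartAt (𝓡 4) p p →
        G ((extChartAt (𝓡 4) p).symm y) = a / ‖y - extChartAt (𝓡 4) p p‖ ^ 2 + b) →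
      b < S → 0 < ρ₁ → a / (S - b) < ρ₁ ^ 2 →
      (∀ x, x ≠ p → S ≤ G x →
        x ∈ (extChartAt (𝓡 4) p).source ∧ extChartAt (𝓡 4) p x ∈ Metric.ball (extChartAt (𝓡 4) p p) r) →
      ∀ x, x ≠ p → S ≤ G x →
        x ∈ {x | x ∈ (extChartAt (𝓡 4) p).source ∧
          extChartAt (𝓡 4) p x ∈ Metric.ball (extChartAt (𝓡 4) p p) ρ₁} :=
  fun _ _ _ _ _ _ _ _ _ _ _ _ _ _ _ _ _ hGform hbS hρ₁pos hρ₁ hcaptS ↦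
    GluingAllScalesSchwarzschild.capture_small hGform hbS hρ₁pos hρ₁ hcaptS

end Summit.SmoothPoincare4.SmoothPoincare4.Theorems

end
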